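import Literature.NumberTheory.EllipticCurves.NeronModelExtensionLocal
import Mathlib.AlgebraicGeometry.Sites.Fpqc
import Mathlib.AlgebraicGeometry.Morphisms.SchemeTheoreticallyDominant
import Mathlib.AlgebraicGeometry.Morphisms.Separated
import Mathlib.AlgebraicGeometry.Morphisms.Flat
import Literature.AlgebraicGeometry.Limits.SeparatedSchematicExt
import HarnessLib

/-!
# Extending a morphism across a schematically dense subscheme is an fpqc-local problem

Topic: `Literature/AlgebraicGeometry/Morphisms`. THEOREMS ONLY (no definition, no named fact,
no `sorry`). Cell `hodgecm-mathlib` (D-0151), road W toward the floor binder r₀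
(`exists_isAbelianSchemeModel_of_hasGoodReductionAt`), leaf **(W4)** of the r₀ census (A-p11
`READSECOND-r0-roadW-proper-case`, B-plan1 `R0-SPEC` §5/§6; director BATCH 117, B-plan1 ruling
2026-08-28T11:28:50Z «one writer B-p12, bytes of §1 = B-p05's farm-green draft 8f39c3063358085b»):
«descent `R′ → R` of "the group law `m` is a morphism"». Banked generic leaf; no floor change.

Let `π : X′ → X` be an fpqc covering of the source (surjective, flat, quasi-compact — e.g. the base
change `X ×_S S′ → X` of an fpqc covering `S′ → S` of the base, or `X ⊗_R R′ → X` for a faithfully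
flat ring map `R → R′`), `U → X` schematically dense (an open containing the generic fibre of a flat
`R`-scheme, §1; any quasi-compact scheme-theoretically dominant `ι : U → X`, §2) and `Y` separated
over the base. A morphism `U → Y` over the base extends to `X → Y` as soon as it does so after
composing with `π`; the extension is unique.

This is the standard combination of two facts:

* fpqc descent of morphisms — `π` is an effective epimorphism (Mathlib: a surjective flat
  quasi-compact morphism is an `EffectiveEpi`, `AlgebraicGeometry/Sites/Fpqc.lean`; Stacks 023Q;
  Görtz–Wedhorn I, Thm. 14.72: representable functors are fpqc sheaves; BLR §6.1 Thm. 6 (a)), and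
* morphisms to a separated scheme agreeing on a scheme-theoretically dense subscheme are equal
  (Görtz–Wedhorn I, Prop. 9.19; tree `hom_ext_of_ι_comp_eq` (Néron currency, Artin (1.1)) /
  `ext_of_isSchemeTheoreticallyDominant_of_isSeparated`), together with the stability of
  scheme-theoretic dominance under flat base change (EGA IV₃ 11.10.5; Mathlib
  `IsSchemeTheoreticallyDominant.pullbackSnd`).

The descent datum is automatic: the two pull-backs of the given morphism to the kernel pair
`X′ ×_X X′` are morphisms over the base to the separated `Y` which agree on the schematically dense
preimage of `U`, hence agree. No properness, no graph closure, no Zariski Main Theorem.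

## Contents

* §1 (Néron-model currency `Over (Spec R)` / `Opens`, the shape consumed by
  `Literature.NumberTheory.EllipticCurves.weil_extension_of_codimOne`, `ExceptionalLocusPurity`
  and the Koizumi head of road W): `openExtension_of_fpqcCover`, `openExtension_of_faithfullyFlat`.
* §2 (generic `IsPullback` form over an arbitrary base `S`, consumers supply their own fibre
  products): `comp_eq_comp_of_comp_eq_of_isSchemeTheoreticallyDominant` (the descent datum),
  `exists_extension_of_isPullback`, `existsUnique_extension_of_isPullback`, the `pullback`-spelled
  corollaries `exists(Unique)_extension_of_pullback`, and the affine-base instance of the covering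
  hypothesis `surjective_flat_quasiCompact_specMap_of_faithfullyFlat`.

## Use

Road W, after (W0)–(W3) over a faithfully flat extension `R′ ⊇ R` of discrete valuation rings
(e.g. a strict henselisation, leaf (W5)): the `R′`-birational group law of the smooth proper model
becomes a morphism `m′` upstairs, and this file brings «`m` is a morphism» back to `R`
(`𝒳 ×_R 𝒳` is flat and `𝒳` separated over `R`). It is NOT the descent of the model itself
(`Literature.NumberTheory.EllipticCurves.neronModel_descent_strictlyLocal`, BLR §6.5).

## References

* S. Bosch, W. Lütkebohmert, M. Raynaud, *Néron Models*, Springer 1990, §1.2 Prop. 2 (c), §6.1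
  Thm. 6 (a), §6.5, §7.2 Prop. 1. [BLRNeronModels1990]
* The Stacks Project, Tag 023Q (fpqc coverings are universal effective epimorphisms).
  [StacksProject]
* M. Artin, *Néron Models*, in Cornell–Silverman (eds.), *Arithmetic Geometry*, Springer 1986, §1
  (1.1) (uniqueness of extensions). [Artin1986NeronModels]
* A. Grothendieck, J. Dieudonné, EGA IV₂ (Publ. Math. IHÉS 24, 1965), Prop. 2.7.1; EGA IV₃
  (Publ. Math. IHÉS 28, 1966), 11.10.5. [GrothendieckDieudonne1965] [EGAIV3]
* U. Görtz, T. Wedhorn, *Algebraic Geometry I: Schemes*, 2nd ed. (2020), Prop. 9.19, Rem. 9.20,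
  Prop. 14.7, Thm. 14.72. [GortzWedhorn2020]
-/


noncomputable section

open CategoryTheory CategoryTheory.Limits AlgebraicGeometry

universe u

namespace Literature.AlgebraicGeometry.Morphisms

/-! ## §1 Néron-model currency: an open `U ⊇` generic fibre of a flat `R`-scheme -/

section NeronCurrency

open Literature.NumberTheory.EllipticCurves (specGenericPoint hom_ext_of_ι_comp_eq exists_lift_opens)

variable (R : Type u) [CommRing R] (K : Type u) [Field K] [Algebra R K] [IsFractionRing R K]

/-- **The extension problem is fpqc-local on the source.**  Let `R` be a ring with field of fractions `K`,
`𝒜 → Spec R` separated, `𝒳 → Spec R` flat with total space `X`, `U ⊆ X` an open containing the generic fibre,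
`g : U → 𝒜` a morphism, and `π : X′ → X` surjective, flat and quasi-compact.  If there is `f′ : X′ → 𝒜` over
`R` whose restriction to `π⁻¹ U` is `π|_{π⁻¹U} ≫ g`, then `g` extends to an `R`-morphism `f : X → 𝒜` (with
`U.ι ≫ f = g`, so that `g` was an `R`-morphism; `f` is unique by `hom_ext_of_ι_comp_eq`).  Proof: `π` is an effective epimorphism (fpqc descent,
[Stacks 023Q]); `f′` equalises the kernel pair `X′ ×_X X′ ⇉ X′` because the two composites are `R`-morphisms from a
flat `R`-scheme to the separated `𝒜` agreeing on the preimage of `U ⊇ 𝒳_K` (`hom_ext_of_ι_comp_eq`).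
[cite: StacksProject, Tag 023Q] [cite: BLRNeronModels1990, §6.5 and Prop. 7.2/1] -/
theorem openExtension_of_fpqcCover (𝒜 𝒳 : Over (Spec (.of R))) [IsSeparated 𝒜.hom] [Flat 𝒳.hom]
    (U : 𝒳.left.Opens)
    (hU : 𝒳.hom.base ⁻¹' Set.range (specGenericPoint R K).base ⊆ (U : Set 𝒳.left))
    (g : (U : Scheme.{u}) ⟶ 𝒜.left)
    {X' : Scheme.{u}} (π : X' ⟶ 𝒳.left) [Surjective π] [Flat π] [QuasiCompact π]
    (f' : X' ⟶ 𝒜.left) (hf' : f' ≫ 𝒜.hom = π ≫ 𝒳.hom)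
    (hres : (π ⁻¹ᵁ U).ι ≫ f' = (π ∣_ U) ≫ g) :
    ∃ f : 𝒳.left ⟶ 𝒜.left, f ≫ 𝒜.hom = 𝒳.hom ∧ U.ι ≫ f = g := by
  -- `f'` equalises the kernel pair of `π`
  have key : ∀ {Z : Scheme.{u}} (g₁ g₂ : Z ⟶ X'), g₁ ≫ π = g₂ ≫ π → g₁ ≫ f' = g₂ ≫ f' := by
    suffices hW : pullback.fst π π ≫ f' = pullback.snd π π ≫ f' by
      intro Z g₁ g₂ h12
      rw [← pullback.lift_fst g₁ g₂ h12, Category.assoc, hW, ← Category.assoc, pullback.lift_snd]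
    -- the kernel pair as a flat `R`-scheme
    let 𝒲 : Over (Spec (.of R)) := Over.mk (pullback.fst π π ≫ π ≫ 𝒳.hom)
    haveI : Flat 𝒲.hom := by
      change Flat (pullback.fst π π ≫ π ≫ 𝒳.hom)
      infer_instance
    -- the open preimage of `U` contains the generic fibre of `𝒲`
    let V : (pullback π π).Opens := (pullback.fst π π ≫ π) ⁻¹ᵁ U
    have hV : 𝒲.hom.base ⁻¹' Set.range (specGenericPoint R K).base ⊆
        ((V : (pullback π π).Opens) : Set ↥(pullback π π)) :=
      fun w hw => hU hw
    -- both composites restricted to `V` are `(lift to U) ≫ g`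
    have hr₁ : Set.range (V.ι ≫ pullback.fst π π).base ⊆ ((π ⁻¹ᵁ U : X'.Opens) : Set X') := by
      rintro _ ⟨v, rfl⟩
      exact v.2
    have hr₂ : Set.range (V.ι ≫ pullback.snd π π).base ⊆ ((π ⁻¹ᵁ U : X'.Opens) : Set X') := by
      rintro _ ⟨v, rfl⟩
      have hv : (pullback.fst π π ≫ π).base (V.ι.base v) ∈ (U : Set 𝒳.left) := v.2
      show (pullback.snd π π ≫ π).base (V.ι.base v) ∈ (U : Set 𝒳.left)
      rwa [← pullback.condition]
    obtain ⟨l₁, hl₁⟩ := exists_lift_opens (π ⁻¹ᵁ U) (V.ι ≫ pullback.fst π π) hr₁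
    obtain ⟨l₂, hl₂⟩ := exists_lift_opens (π ⁻¹ᵁ U) (V.ι ≫ pullback.snd π π) hr₂
    have hl : l₁ ≫ (π ∣_ U) = l₂ ≫ (π ∣_ U) := by
      rw [← cancel_mono U.ι, Category.assoc, Category.assoc, morphismRestrict_ι, ← Category.assoc,
        hl₁, ← Category.assoc, hl₂, Category.assoc, Category.assoc, pullback.condition]
    refine hom_ext_of_ι_comp_eq R K 𝒜 𝒲 V hV (a := pullback.fst π π ≫ f')
      (b := pullback.snd π π ≫ f') ?_ ?_ ?_
    · change (pullback.fst π π ≫ f') ≫ 𝒜.hom = pullback.fst π π ≫ π ≫ 𝒳.hom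
      rw [Category.assoc, hf']
    · change (pullback.snd π π ≫ f') ≫ 𝒜.hom = pullback.fst π π ≫ π ≫ 𝒳.hom
      rw [Category.assoc, hf', ← Category.assoc, ← pullback.condition, Category.assoc]
    · calc V.ι ≫ pullback.fst π π ≫ f'
          = (l₁ ≫ (π ⁻¹ᵁ U).ι) ≫ f' := by rw [hl₁, Category.assoc]
        _ = l₁ ≫ (π ∣_ U) ≫ g := by rw [Category.assoc, hres]
        _ = l₂ ≫ (π ∣_ U) ≫ g := by rw [← Category.assoc, hl, Category.assoc]
        _ = (l₂ ≫ (π ⁻¹ᵁ U).ι) ≫ f' := by rw [Category.assoc, hres]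
        _ = V.ι ≫ pullback.snd π π ≫ f' := by rw [hl₂, Category.assoc]
  -- descend along the effective epimorphism `π`
  refine ⟨EffectiveEpi.desc π f' key, ?_, ?_⟩
  · rw [← cancel_epi π, EffectiveEpi.fac_assoc, hf']
  · haveI : Surjective (π ∣_ U) := IsZariskiLocalAtTarget.restrict ‹Surjective π› U
    rw [← cancel_epi (π ∣_ U), ← Category.assoc, morphismRestrict_ι, Category.assoc,
      EffectiveEpi.fac, hres]

/-- **Base-change form: the extension problem descends along a faithfully flat ring extension.**  With `R`,
`K`, `𝒜` separated, `𝒳` flat, `U ⊇ 𝒳_K` and `g : U → 𝒜` as above, let `φ : R → R′` be faithfully flat and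
`π : X ×_{Spec R} Spec R′ → X` the first projection.  If the base-changed rational map extends
(`f′ : X ×_R R′ → 𝒜` over `R` with `f′|_{π⁻¹U} = π|_{π⁻¹U} ≫ g`), then `g` extends to an `R`-morphism
`X → 𝒜`.  (Road W, leaf (W4): brings «the group law is a morphism» back from a faithfully flat extension
`R′` of the discrete valuation ring `R`.) [cite: BLRNeronModels1990, §6.5 and Prop. 7.2/1]
[cite: StacksProject, Tag 023Q] -/
theorem openExtension_of_faithfullyFlat (𝒜 𝒳 : Over (Spec (.of R))) [IsSeparated 𝒜.hom] [Flat 𝒳.hom]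
    (U : 𝒳.left.Opens)
    (hU : 𝒳.hom.base ⁻¹' Set.range (specGenericPoint R K).base ⊆ (U : Set 𝒳.left))
    (g : (U : Scheme.{u}) ⟶ 𝒜.left)
    (R' : Type u) [CommRing R'] (φ : R →+* R') (hφ : φ.FaithfullyFlat)
    (f' : pullback 𝒳.hom (Spec.map (CommRingCat.ofHom φ)) ⟶ 𝒜.left)
    (hf' : f' ≫ 𝒜.hom = pullback.fst 𝒳.hom (Spec.map (CommRingCat.ofHom φ)) ≫ 𝒳.hom)
    (hres : ((pullback.fst 𝒳.hom (Spec.map (CommRingCat.ofHom φ))) ⁻¹ᵁ U).ι ≫ f' =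
      ((pullback.fst 𝒳.hom (Spec.map (CommRingCat.ofHom φ))) ∣_ U) ≫ g) :
    ∃ f : 𝒳.left ⟶ 𝒜.left, f ≫ 𝒜.hom = 𝒳.hom ∧ U.ι ≫ f = g := by
  obtain ⟨hfl, hsu⟩ := (flat_and_surjective_SpecMap_iff (CommRingCat.ofHom φ)).2 hφ
  haveI := hfl
  haveI := hsu
  haveI : Surjective (pullback.fst 𝒳.hom (Spec.map (CommRingCat.ofHom φ))) :=
    MorphismProperty.pullback_fst _ _ hsu
  exact openExtension_of_fpqcCover R K 𝒜 𝒳 U hU g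
    (pullback.fst 𝒳.hom (Spec.map (CommRingCat.ofHom φ))) f' hf' hres

end NeronCurrency

/-! ## §2 Generic form: a quasi-compact scheme-theoretically dominant `U → X` over any base `S` -/

variable {S S' X X' U U' Y : Scheme.{u}}

section IsPullbackForm

variable {a : S' ⟶ S} [Surjective a] [Flat a] [QuasiCompact a]
  {pX : X ⟶ S} {qX : X' ⟶ X} {pX' : X' ⟶ S'} (hX : IsPullback qX pX' pX a)
  {ι : U ⟶ X} [IsSchemeTheoreticallyDominant ι] [QuasiCompact ι]
  {qU : U' ⟶ U} {ι' : U' ⟶ X'} (hU : IsPullback qU ι' ι qX)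
  (pY : Y ⟶ S) [IsSeparated pY] (f : U ⟶ Y) (h : X' ⟶ Y)
  (hh : h ≫ pY = qX ≫ pX) (hf : ι' ≫ h = qU ≫ f)

omit [Surjective a] [QuasiCompact a] in
include hX in
/-- The base change `X' = X ×_S S' → X` of an fpqc covering `S' → S` is flat.
[cite: GrothendieckDieudonne1965, Prop. 2.7.1 (setting)] -/
theorem flat_of_isPullback_of_flat : Flat qX :=
  MorphismProperty.of_isPullback (P := @Flat) hX.flip inferInstance

omit [Flat a] [QuasiCompact a] in
include hX in
/-- The base change `X' = X ×_S S' → X` of an fpqc covering `S' → S` is surjective.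
[cite: GrothendieckDieudonne1965, Prop. 2.7.1 (setting)] -/
theorem surjective_of_isPullback_of_surjective : Surjective qX :=
  MorphismProperty.of_isPullback (P := @Surjective) hX.flip inferInstance

omit [Surjective a] [Flat a] in
include hX in
/-- The base change `X' = X ×_S S' → X` of an fpqc covering `S' → S` is quasi-compact.
[cite: GrothendieckDieudonne1965, Prop. 2.7.1 (setting)] -/
theorem quasiCompact_of_isPullback_of_quasiCompact : QuasiCompact qX :=
  MorphismProperty.of_isPullback (P := @QuasiCompact) hX.flip inferInstance

include hX in
/-- The base change `X' = X ×_S S' → X` of an fpqc covering `S' → S` is an effective epimorphism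
of schemes (fpqc descent of morphisms; Mathlib: surjective + flat + quasi-compact ⇒
`EffectiveEpi`). [cite: GortzWedhorn2020, Thm. 14.72] -/
theorem effectiveEpi_of_isPullback : EffectiveEpi qX := by
  haveI := flat_of_isPullback_of_flat hX
  haveI := surjective_of_isPullback_of_surjective hX
  haveI := quasiCompact_of_isPullback_of_quasiCompact hX
  infer_instance

omit [Surjective a] [QuasiCompact a] in
include hX hU hh hf in
/-- **The descent datum is automatic.** With notation as in the module docstring: if an
`S`-morphism `h : X' → Y` out of the fpqc base change `X' = X ×_S S'` restricts on
`U' = U ×_X X'` to (the pull-back of) `f : U → Y`, where `ι : U → X` is quasi-compact and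
scheme-theoretically dominant and `Y → S` is separated, then `h` coequalises every pair
`g₁ g₂ : Z → X'` with `g₁ ≫ qX = g₂ ≫ qX` — in particular the kernel pair of `X' → X`. Proof: on
the kernel pair `X' ×_X X'`, the two composites with `h` are `S`-morphisms to `Y` which agree on
the scheme-theoretically dominant `U ×_X (X' ×_X X') → X' ×_X X'` (flat base change of `ι`,
EGA IV₃ 11.10.5), hence agree (Görtz–Wedhorn I, Prop. 9.19).
[cite: EGAIV3, 11.10.5] [cite: GortzWedhorn2020, Prop. 9.19] -/
theorem comp_eq_comp_of_comp_eq_of_isSchemeTheoreticallyDominant {Z : Scheme.{u}}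
    (g₁ g₂ : Z ⟶ X') (hg : g₁ ≫ qX = g₂ ≫ qX) : g₁ ≫ h = g₂ ≫ h := by
  haveI := flat_of_isPullback_of_flat hX
  -- the kernel pair of `qX`
  let p₁ : pullback qX qX ⟶ X' := pullback.fst qX qX
  let p₂ : pullback qX qX ⟶ X' := pullback.snd qX qX
  have hp : p₁ ≫ qX = p₂ ≫ qX := pullback.condition
  -- `U ×_X (X' ×_X X') → X' ×_X X'` is scheme-theoretically dominant (flat base change of `ι`)
  haveI : Flat (p₁ ≫ qX) := inferInstance
  haveI : IsSchemeTheoreticallyDominant (pullback.snd ι (p₁ ≫ qX)) := inferInstance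
  have key : p₁ ≫ h = p₂ ≫ h := by
    refine Literature.AlgebraicGeometry.Limits.ext_of_isSchemeTheoreticallyDominant_of_isSeparated
      pY ?_ (pullback.snd ι (p₁ ≫ qX)) ?_
    · rw [Category.assoc, Category.assoc, hh, ← Category.assoc, ← Category.assoc, hp]
    · -- both composites restricted to `U ×_X (X' ×_X X')` are `pr_U ≫ f`
      have e : ∀ (p : pullback qX qX ⟶ X') (hpq : p ≫ qX = p₁ ≫ qX),
          pullback.snd ι (p₁ ≫ qX) ≫ p ≫ h = pullback.fst ι (p₁ ≫ qX) ≫ f := by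
        intro p hpq
        have w : pullback.fst ι (p₁ ≫ qX) ≫ ι = (pullback.snd ι (p₁ ≫ qX) ≫ p) ≫ qX := by
          rw [Category.assoc, hpq]; exact pullback.condition
        calc pullback.snd ι (p₁ ≫ qX) ≫ p ≫ h
            = (hU.lift _ _ w ≫ ι') ≫ h := by rw [hU.lift_snd, Category.assoc]
          _ = hU.lift _ _ w ≫ qU ≫ f := by rw [Category.assoc, hf]
          _ = pullback.fst ι (p₁ ≫ qX) ≫ f := by rw [← Category.assoc, hU.lift_fst]
      rw [e p₁ rfl, e p₂ hp.symm]
  calc g₁ ≫ h = pullback.lift g₁ g₂ hg ≫ p₁ ≫ h := by rw [← Category.assoc, pullback.lift_fst]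
    _ = pullback.lift g₁ g₂ hg ≫ p₂ ≫ h := by rw [key]
    _ = g₂ ≫ h := by rw [← Category.assoc, pullback.lift_snd]

include hX hU hh hf in
/-- **Extension of a morphism descends along an fpqc covering (existence).** Let `S' → S` be
surjective, flat and quasi-compact, `X' = X ×_S S'` (`hX`), `ι : U → X` quasi-compact and
scheme-theoretically dominant with base change `U' = U ×_X X'` (`hU`), `Y → S` separated,
`f : U → Y`, and `h : X' → Y` an `S`-morphism with `ι' ≫ h = qU ≫ f`. Then `h` descends to a
morphism `g : X → Y` (fpqc descent of morphisms, the descent datum being automatic by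
`comp_eq_comp_of_comp_eq_of_isSchemeTheoreticallyDominant`), and `g` is an `S`-morphism extending
`f`. [cite: GortzWedhorn2020, Thm. 14.72 with Prop. 9.19] [cite: BLRNeronModels1990, §6.1 Thm. 6 (a)] -/
theorem exists_extension_of_isPullback :
    ∃ g : X ⟶ Y, qX ≫ g = h ∧ ι ≫ g = f ∧ g ≫ pY = pX := by
  haveI := effectiveEpi_of_isPullback hX
  haveI := flat_of_isPullback_of_flat hX
  haveI := surjective_of_isPullback_of_surjective hX
  haveI := quasiCompact_of_isPullback_of_quasiCompact hX
  -- `qU : U' → U` is again surjective, flat and quasi-compact, hence an epimorphism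
  haveI : Flat qU := MorphismProperty.of_isPullback (P := @Flat) hU.flip inferInstance
  haveI : Surjective qU := MorphismProperty.of_isPullback (P := @Surjective) hU.flip inferInstance
  haveI : QuasiCompact qU :=
    MorphismProperty.of_isPullback (P := @QuasiCompact) hU.flip inferInstance
  have hdesc : ∀ {Z : Scheme.{u}} (g₁ g₂ : Z ⟶ X'), g₁ ≫ qX = g₂ ≫ qX → g₁ ≫ h = g₂ ≫ h :=
    fun g₁ g₂ hg =>
      comp_eq_comp_of_comp_eq_of_isSchemeTheoreticallyDominant hX hU pY f h hh hf g₁ g₂ hg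
  refine ⟨EffectiveEpi.desc qX h hdesc, EffectiveEpi.fac qX h hdesc, ?_, ?_⟩
  · rw [← cancel_epi qU]
    calc qU ≫ ι ≫ EffectiveEpi.desc qX h hdesc
        = ι' ≫ qX ≫ EffectiveEpi.desc qX h hdesc := by rw [← Category.assoc, hU.w, Category.assoc]
      _ = qU ≫ f := by rw [EffectiveEpi.fac, hf]
  · rw [← cancel_epi qX, EffectiveEpi.fac_assoc, hh]

include hX in
/-- A morphism out of `X` is determined by its composite with the fpqc base change
`X' = X ×_S S' → X` (an epimorphism). [cite: GortzWedhorn2020, Thm. 14.72] -/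
theorem eq_of_comp_eq_of_isPullback {g₁ g₂ : X ⟶ Y} (hg : qX ≫ g₁ = qX ≫ g₂) : g₁ = g₂ := by
  haveI := effectiveEpi_of_isPullback hX
  exact (cancel_epi qX).mp hg

omit [QuasiCompact ι] in
/-- An `S`-morphism `X → Y` to the separated `Y → S` is determined by its restriction to the
scheme-theoretically dominant `ι : U → X`. [cite: GortzWedhorn2020, Prop. 9.19] -/
theorem eq_of_comp_eq_of_isSchemeTheoreticallyDominant {g₁ g₂ : X ⟶ Y} (h₁ : g₁ ≫ pY = pX)
    (h₂ : g₂ ≫ pY = pX) (hg : ι ≫ g₁ = ι ≫ g₂) : g₁ = g₂ :=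
  Literature.AlgebraicGeometry.Limits.ext_of_isSchemeTheoreticallyDominant_of_isSeparated pY
    (h₁.trans h₂.symm) ι hg

include hX hU hh hf in
/-- **Extension of a morphism descends along an fpqc covering (unique existence).** With the
hypotheses of `exists_extension_of_isPullback`: there is a unique `S`-morphism `g : X → Y` with
`ι ≫ g = f`; moreover its base change is the given `h` (`exists_extension_of_isPullback`).
[cite: GortzWedhorn2020, Thm. 14.72 with Prop. 9.19] [cite: BLRNeronModels1990, §6.1 Thm. 6 (a)] -/
theorem existsUnique_extension_of_isPullback : ∃! g : X ⟶ Y, ι ≫ g = f ∧ g ≫ pY = pX := by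
  obtain ⟨g, -, hgf, hgS⟩ := exists_extension_of_isPullback hX hU pY f h hh hf
  exact ⟨g, ⟨hgf, hgS⟩, fun g' hg' =>
    eq_of_comp_eq_of_isSchemeTheoreticallyDominant pY hg'.2 hgS (hg'.1.trans hgf.symm)⟩

end IsPullbackForm

/-- **Extension of a morphism descends along an fpqc covering (`pullback` form).** Let
`a : S' → S` be surjective, flat and quasi-compact, `pX : X → S`, `ι : U → X` quasi-compact and
scheme-theoretically dominant, `pY : Y → S` separated and `f : U → Y`. If there is an
`S`-morphism `h : X ×_S S' → Y` whose restriction to `U ×_X (X ×_S S')` is the pull-back of `f`,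
then `f` extends uniquely to an `S`-morphism `X → Y`.
[cite: GortzWedhorn2020, Thm. 14.72 with Prop. 9.19] [cite: BLRNeronModels1990, §6.1 Thm. 6 (a)] -/
theorem existsUnique_extension_of_pullback {a : S' ⟶ S} [Surjective a] [Flat a] [QuasiCompact a]
    (pX : X ⟶ S) {ι : U ⟶ X} [IsSchemeTheoreticallyDominant ι] [QuasiCompact ι]
    (pY : Y ⟶ S) [IsSeparated pY] (f : U ⟶ Y) (h : pullback pX a ⟶ Y)
    (hh : h ≫ pY = pullback.fst pX a ≫ pX)
    (hf : pullback.snd ι (pullback.fst pX a) ≫ h = pullback.fst ι (pullback.fst pX a) ≫ f) :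
    ∃! g : X ⟶ Y, ι ≫ g = f ∧ g ≫ pY = pX :=
  existsUnique_extension_of_isPullback (IsPullback.of_hasPullback pX a)
    (IsPullback.of_hasPullback ι (pullback.fst pX a)) pY f h hh hf

/-- With the hypotheses of `existsUnique_extension_of_pullback`, the unique extension `g` also
satisfies `pullback.fst pX a ≫ g = h` (its base change to `S'` is the given local extension).
[cite: GortzWedhorn2020, Thm. 14.72 with Prop. 9.19] -/
theorem exists_extension_of_pullback {a : S' ⟶ S} [Surjective a] [Flat a] [QuasiCompact a]
    (pX : X ⟶ S) {ι : U ⟶ X} [IsSchemeTheoreticallyDominant ι] [QuasiCompact ι]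
    (pY : Y ⟶ S) [IsSeparated pY] (f : U ⟶ Y) (h : pullback pX a ⟶ Y)
    (hh : h ≫ pY = pullback.fst pX a ≫ pX)
    (hf : pullback.snd ι (pullback.fst pX a) ≫ h = pullback.fst ι (pullback.fst pX a) ≫ f) :
    ∃ g : X ⟶ Y, pullback.fst pX a ≫ g = h ∧ ι ≫ g = f ∧ g ≫ pY = pX :=
  exists_extension_of_isPullback (IsPullback.of_hasPullback pX a)
    (IsPullback.of_hasPullback ι (pullback.fst pX a)) pY f h hh hf

/-- **Affine base.** For a faithfully flat ring map `φ : R → R'`, `Spec R' → Spec R` is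
surjective, flat and quasi-compact — an fpqc covering to which the descent statements above apply
(e.g. `R` a discrete valuation ring and `R'` a faithfully flat extension such as a strict
henselisation or a complete unramified extension). [cite: GrothendieckDieudonne1965, Prop. 2.7.1 (setting)] -/
theorem surjective_flat_quasiCompact_specMap_of_faithfullyFlat {R R' : Type u} [CommRing R]
    [CommRing R'] (φ : R →+* R') (hφ : φ.FaithfullyFlat) :
    Surjective (Spec.map (CommRingCat.ofHom φ)) ∧ Flat (Spec.map (CommRingCat.ofHom φ)) ∧
      QuasiCompact (Spec.map (CommRingCat.ofHom φ)) := by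
  have h := (flat_and_surjective_SpecMap_iff (CommRingCat.ofHom φ)).mpr hφ
  exact ⟨h.2, h.1, inferInstance⟩

end Literature.AlgebraicGeometry.Morphisms

end
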